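import Literature.MathematicalPhysics.QuantumFieldTheory.YangMillsOS
import Literature.MathematicalPhysics.QuantumLattice.YangMillsClassical
import HarnessLib

/-!
# Reduction of the local Morse–Bott inequality to GAUGE-MINIMAL configurations (compactness of the lattice gauge group)
# (route-independent helper toward the crux `TwistExponentGap.RigidTwistCeiling` ⟨stmt-QuantumFields-24054⟩, step (W3); free hands
# of width seat ym-line-sfw-p2-w3)

For a faithful unitary continuous `ρ` on a compact `G`, a reference configuration `U₀` on the torus `(ℤ/S)^d`, and a
GAUGE-INVARIANT functional `S` (the twisted Wilson action), suppose the quadratic-growth inequality `c‖ρ(V e) − ρ(U₀ e)‖² ≤ S(V)`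
holds for every `V` that is (i) link-wise `ε₁`-close to `U₀` and (ii) GAUGE-MINIMAL: no lattice gauge transform of `U₀` is closer to
`V` in the summed squared Hilbert–Schmidt distance.  Then the local Morse–Bott inequality (MB_loc) of ✓p775343 holds at `U₀`: every
`U` in a neighbourhood of `U₀` is within `S(U)/c` of the gauge orbit of `U₀` (`localMorseBott_of_gaugeMinimal`).  Mechanism: minimise
`h ↦ Σ_e ‖ρ(U e) − ρ((h·U₀) e)‖²` over the compact gauge group `G^{sites}`, move the minimiser onto `U` (unitary invariance of the
Frobenius norm), use gauge invariance of `S`.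
HONEST FRAMING: topology/bookkeeping; nothing here bears on a summit statement or on the Yang–Mills mass gap.
-/

set_option autoImplicit false

noncomputable section

open scoped Matrix Matrix.Norms.Frobenius Topology BigOperators
open Filter
open Literature.MathematicalPhysics.QuantumFieldTheory

namespace Summit.QuantumFields.YangMills.Theorems.TwistExponentGap

variable {G : Type*} [Group G] [TopologicalSpace G] [IsTopologicalGroup G] [CompactSpace G]

omit [IsTopologicalGroup G] [CompactSpace G] in
/-- Unitary two-sided invariance of the Frobenius distance under a representation:
`‖ρ(a) (P − Q) ρ(b)‖ = ‖P − Q‖`, in the form `‖ρ(a·u·b) − ρ(a·v·b)‖ = ‖ρ u − ρ v‖`. -/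
theorem norm_rho_conj_sub (r : LatticeRep G) (a b u v : G) :
    ‖r.ρ (a * u * b) - r.ρ (a * v * b)‖ = ‖r.ρ u - r.ρ v‖ := by
  have h : r.ρ (a * u * b) - r.ρ (a * v * b) = r.ρ a * (r.ρ u - r.ρ v) * r.ρ b := by
    simp only [map_mul]; noncomm_ring
  rw [h, Matrix.frobenius_norm_mul_unitaryGroup _ ⟨r.ρ b, r.mem_unitary b⟩,
    Matrix.frobenius_norm_unitaryGroup_mul ⟨r.ρ a, r.mem_unitary a⟩]

/-- **Gauge reduction.**  If quadratic growth `c‖ρ(V e) − ρ(U₀ e)‖² ≤ S V` holds for all link-wise `ε₁`-close, gauge-minimal `V`,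
then every `U` near `U₀` is within `S(U)/c` of the gauge orbit of `U₀` (for gauge-invariant `S`). -/
theorem localMorseBott_of_gaugeMinimal (r : LatticeRep G) {d S : ℕ} [NeZero S] (U₀ : GaugeConfig d S G)
    (Sf : GaugeConfig d S G → ℝ) (hSinv : ∀ (g : Site d S → G) (U : GaugeConfig d S G), Sf (gaugeTransform g U) = Sf U)
    {ε₁ c : ℝ} (hε₁ : 0 < ε₁)
    (hcore : ∀ V : GaugeConfig d S G, (∀ e, ‖r.ρ (V e) - r.ρ (U₀ e)‖ ≤ ε₁) →
      (∀ h : Site d S → G, ∑ e, ‖r.ρ (V e) - r.ρ (U₀ e)‖ ^ 2 ≤ ∑ e, ‖r.ρ (V e) - r.ρ (gaugeTransform h U₀ e)‖ ^ 2) →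
      ∀ e, c * ‖r.ρ (V e) - r.ρ (U₀ e)‖ ^ 2 ≤ Sf V) :
    ∃ N ∈ 𝓝 U₀, ∀ U ∈ N, ∃ g : Site d S → G, ∀ e : Edge d S,
      c * ‖r.ρ (U e) - r.ρ (gaugeTransform g U₀ e)‖ ^ 2 ≤ Sf U := by
  classical
  -- the neighbourhood: every link within `ε₀` with `#E · ε₀² ≤ ε₁²`
  set nE : ℕ := Fintype.card (Edge d S) with hnE
  set ε₀ : ℝ := ε₁ / ((nE : ℝ) + 1) with hε₀
  have hnE0 : (0 : ℝ) ≤ nE := Nat.cast_nonneg _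
  have hε₀pos : 0 < ε₀ := div_pos hε₁ (by linarith)
  have hε₀le : (nE : ℝ) * ε₀ ^ 2 ≤ ε₁ ^ 2 := by
    rw [hε₀, div_pow]
    have h1 : (nE : ℝ) ≤ ((nE : ℝ) + 1) ^ 2 := by nlinarith
    calc (nE : ℝ) * (ε₁ ^ 2 / ((nE : ℝ) + 1) ^ 2) = (nE : ℝ) / ((nE : ℝ) + 1) ^ 2 * ε₁ ^ 2 := by ring
      _ ≤ 1 * ε₁ ^ 2 := by
          apply mul_le_mul_of_nonneg_right _ (sq_nonneg _)
          rw [div_le_one (by positivity)]; exact h1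
      _ = ε₁ ^ 2 := one_mul _
  set N : Set (GaugeConfig d S G) := {U | ∀ e, ‖r.ρ (U e) - r.ρ (U₀ e)‖ < ε₀} with hN
  have hNopen : IsOpen N := by
    have : N = ⋂ e, {U : GaugeConfig d S G | ‖r.ρ (U e) - r.ρ (U₀ e)‖ < ε₀} := by
      ext U; simp [hN]
    rw [this]
    exact isOpen_iInter_of_finite fun e =>
      isOpen_lt ((continuous_norm.comp ((r.continuous.comp (continuous_apply e)).sub continuous_const))) continuous_const
  have hU₀N : U₀ ∈ N := fun e => by simp [hε₀pos]
  refine ⟨N, hNopen.mem_nhds hU₀N, fun U hU => ?_⟩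
  -- minimise the distance to the gauge orbit over the compact gauge group
  set D : (Site d S → G) → ℝ := fun h => ∑ e, ‖r.ρ (U e) - r.ρ (gaugeTransform h U₀ e)‖ ^ 2 with hD
  have hDcont : Continuous D := by
    refine continuous_finsetSum _ fun e _ => ?_
    refine (continuous_norm.comp (continuous_const.sub (r.continuous.comp ?_))).pow 2
    -- `h ↦ gaugeTransform h U₀ e = h e.1 * U₀ e * (h (e.1.shift e.2))⁻¹` is continuous
    show Continuous fun h : Site d S → G => h e.1 * U₀ e * (h (e.1.shift e.2))⁻¹
    exact ((continuous_apply e.1).mul continuous_const).mul ((continuous_apply _).inv)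
  obtain ⟨g, -, hgmin⟩ := isCompact_univ.exists_isMinOn (Set.univ_nonempty) hDcont.continuousOn
  -- the gauge-moved configuration `V = g⁻¹ · U`
  set V : GaugeConfig d S G := fun e => (g e.1)⁻¹ * U e * g (e.1.shift e.2) with hV
  have hVU : ∀ e, ‖r.ρ (V e) - r.ρ (U₀ e)‖ = ‖r.ρ (U e) - r.ρ (gaugeTransform g U₀ e)‖ := fun e => by
    have h1 : U e = g e.1 * V e * (g (e.1.shift e.2))⁻¹ := by rw [hV]; group
    have h2 : gaugeTransform g U₀ e = g e.1 * U₀ e * (g (e.1.shift e.2))⁻¹ := rfl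
    rw [h1, h2, norm_rho_conj_sub]
  -- `V` is link-wise `ε₁`-close to `U₀`
  have hsumV : ∑ e, ‖r.ρ (V e) - r.ρ (U₀ e)‖ ^ 2 ≤ (nE : ℝ) * ε₀ ^ 2 := by
    have h1 : ∑ e, ‖r.ρ (V e) - r.ρ (U₀ e)‖ ^ 2 = D g := by simp only [hD, hVU]
    have h2 : D g ≤ D 1 := hgmin (Set.mem_univ _)
    have h3 : D 1 ≤ ∑ _e : Edge d S, ε₀ ^ 2 := by
      refine Finset.sum_le_sum fun e _ => ?_
      have hg1 : gaugeTransform (1 : Site d S → G) U₀ e = U₀ e := by simp [gaugeTransform]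
      rw [hg1]
      have := hU e
      exact pow_le_pow_left₀ (norm_nonneg _) this.le 2
    rw [Finset.sum_const, Finset.card_univ, nsmul_eq_mul] at h3
    linarith
  have hcloseV : ∀ e, ‖r.ρ (V e) - r.ρ (U₀ e)‖ ≤ ε₁ := fun e => by
    have h1 : ‖r.ρ (V e) - r.ρ (U₀ e)‖ ^ 2 ≤ ε₁ ^ 2 :=
      ((Finset.single_le_sum (fun e _ => sq_nonneg (‖r.ρ (V e) - r.ρ (U₀ e)‖)) (Finset.mem_univ e)).trans hsumV).trans
        hε₀le
    exact (pow_le_pow_iff_left₀ (norm_nonneg _) hε₁.le two_ne_zero).1 h1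
  -- `V` is gauge-minimal
  have hminV : ∀ h : Site d S → G,
      ∑ e, ‖r.ρ (V e) - r.ρ (U₀ e)‖ ^ 2 ≤ ∑ e, ‖r.ρ (V e) - r.ρ (gaugeTransform h U₀ e)‖ ^ 2 := by
    intro h
    have h1 : ∑ e, ‖r.ρ (V e) - r.ρ (U₀ e)‖ ^ 2 = D g := by simp only [hD, hVU]
    have h2 : ∑ e, ‖r.ρ (V e) - r.ρ (gaugeTransform h U₀ e)‖ ^ 2 = D (fun x => g x * h x) := by
      simp only [hD]
      refine Finset.sum_congr rfl fun e _ => ?_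
      have e1 : U e = g e.1 * V e * (g (e.1.shift e.2))⁻¹ := by rw [hV]; group
      have e2 : gaugeTransform (fun x => g x * h x) U₀ e = g e.1 * gaugeTransform h U₀ e * (g (e.1.shift e.2))⁻¹ := by
        simp only [gaugeTransform]; group
      rw [e1, e2, norm_rho_conj_sub]
    rw [h1, h2]; exact hgmin (Set.mem_univ _)
  -- `V` is a gauge transform of `U`, so `Sf V = Sf U`
  have hSV : Sf V = Sf U := by
    have : V = gaugeTransform (fun x => (g x)⁻¹) U := by
      funext e; simp only [hV, gaugeTransform, inv_inv]
    rw [this, hSinv]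
  refine ⟨g, fun e => ?_⟩
  rw [← hVU e, ← hSV]
  exact hcore V hcloseV hminV e

end Summit.QuantumFields.YangMills.Theorems.TwistExponentGap

end
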